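import Summits.AtomisticToContinuum.FouriersLaw.Theorems.ParityLiouvilleSeedLiouvilleForHeatHarmonicBoxJensen
import Literature.Probability.Divergences.DonskerVaradhan
import Literature.Probability.LatticeModels.GibbsSpecificationCofinal

/-!
# The radiating Gaussian state of the harmonic chain is regular

Helper file for the harmonic tightness witness of `ParityLiouvilleSeed.LiouvilleForHeat`
(`stmt-AtomisticToContinuum-13980`) / `ZeroCurrentRigidity` (`stmt-AtomisticToContinuum-12073`).

**Theorem** (`regular_harmonicState`): for `ω₂ > 0` there is a shift-invariant DLR Gibbs state `μ`
of the harmonic pinned chain `pinnedChain ω₂ 0 0 γ` at temperature `1` and a finite constant `C`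
with `H(ν_Λ ‖ μ_Λ) ≤ C (n+1)` for every box `Λ = {a, …, a+n}`, `ν = harmonicState ω₂`: the radiating
state is REGULAR in Bernardin's sense (uniformly in the position of the box).

Proof: by the Donsker–Varadhan bound (`klDiv_le_of_forall_integral_le`) it suffices to show
`∫ ψ dν_Λ ≤ C(n+1) + log ∫ e^ψ dμ_Λ` for bounded measurable `ψ`. By DLR,
`∫ e^{ψ∘box} dμ = ∫ γ_Λ(e^{ψ∘box} | η) dμ(η)`, and `γ_Λ(e^{ψ∘box} | η) = N_Λ(η)/Z_Λ(η)` with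
`Z_Λ(η) ≤ z₀^{n+1}` and the entropy step `N_Λ(η) ≥ exp(∫ψ dν_Λ - A(n+1) - q_{a-1}(η)² - q_{a+n+1}(η)²)`
(`boxN_ge`); restricting to the boundary conditions with `|q_{a-1}|, |q_{a+n+1}| ≤ R`, which have
`μ`-probability `≥ 1/2` uniformly in `a, n` (Chebyshev), gives the claim.
-/

noncomputable section

open MeasureTheory ProbabilityTheory Filter Set Function InformationTheory
open scoped NNReal ENNReal
open Literature.MathematicalPhysics.KineticTheory.HeatConduction Literature.Probability.LatticeModels

namespace Summit.AtomisticToContinuum.FouriersLaw.Theorems.ParityLiouvilleSeed.HarmonicWitness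

variable (ω₂ : ℝ)

/-- **Lower bound for Gibbs expectations of exponential box observables.** For the shift-invariant
Gibbs state with boundary control, every box and every bounded measurable `ψ`:
`exp(∫ ψ dν_Λ - (n+1)(A + log m) - 2R² - log 2) ≤ ∫ e^{ψ(box σ)} dμ(σ)`. [folklore] -/
theorem exp_le_integral_exp_comp_box (hω : 0 < ω₂) (γ : ℝ) {μ : Measure ChainConfig} [IsProbabilityMeasure μ]
    (hG : (pinnedChain ω₂ 0 0 γ).IsChainGibbsMeasure 1 μ) {R : ℝ}
    (hgood : ∀ x y : ℤ, (1 / 2 : ℝ) ≤ μ.real {σ : ChainConfig | |(σ x).1| ≤ R ∧ |(σ y).1| ≤ R})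
    (a : ℤ) (n : ℕ) {ψ : (Fin (n + 1) → ℝ × ℝ) → ℝ} (hψ : Measurable ψ) {Cψ : ℝ} (hψb : ∀ x, |ψ x| ≤ Cψ) :
    Real.exp ((∫ x, ψ x ∂boxMarginal a n (harmonicState ω₂)) -
        (n + 1) * ((((noiseVar ω₂ 1 : ℝ) + 2) / 2 + (ω₂ / 2 + 2) -
          (Real.log (Real.sqrt (2 * Real.pi)) + Real.log (Real.sqrt (2 * Real.pi * noiseVar ω₂ 1)))) +
          Real.log (max (∫⁻ z : ℝ × ℝ, ENNReal.ofReal (Real.exp (-(1 : ℝ)⁻¹ *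
            (z.2 ^ 2 / 2 + (pinnedChain ω₂ 0 0 γ).U z.1)))).toReal 1)) -
        2 * R ^ 2 - Real.log 2) ≤
      ∫ σ, Real.exp (ψ (boxRestrictAt a n σ)) ∂μ := by
  -- notation
  set P := pinnedChain ω₂ 0 0 γ with hP
  set Λ := Finset.Icc a (a + n) with hΛ
  set A : ℝ := ((noiseVar ω₂ 1 : ℝ) + 2) / 2 + (ω₂ / 2 + 2) -
    (Real.log (Real.sqrt (2 * Real.pi)) + Real.log (Real.sqrt (2 * Real.pi * noiseVar ω₂ 1))) with hA
  set z₀ : ℝ≥0∞ := ∫⁻ z : ℝ × ℝ, ENNReal.ofReal (Real.exp (-(1 : ℝ)⁻¹ * (z.2 ^ 2 / 2 + P.U z.1))) with hz₀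
  set m : ℝ := max z₀.toReal 1 with hm
  have hm1 : 1 ≤ m := le_max_right _ _
  have hm0 : 0 < m := lt_of_lt_of_le one_pos hm1
  set Iψ : ℝ := ∫ x, ψ x ∂boxMarginal a n (harmonicState ω₂) with hIψ
  set Φ : ChainConfig → ℝ := fun σ => Real.exp (ψ (boxRestrictAt a n σ)) with hΦ
  set W : ChainConfig → ℝ≥0∞ := fun σ =>
    ENNReal.ofReal (Real.exp (-(1 : ℝ)⁻¹ * hamiltonianIn P.chainPotential OscillatorChain.chainSupp Λ σ)) with hW
  set Nl : ChainConfig → ℝ≥0∞ := fun η => ∫⁻ x : Fin (n + 1) → ℝ × ℝ, ENNReal.ofReal (Real.exp (ψ x) *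
    Real.exp (-(1 : ℝ)⁻¹ * hamiltonianIn P.chainPotential OscillatorChain.chainSupp Λ (insBox a n η x))) with hNl
  set Zl : ChainConfig → ℝ≥0∞ := fun η => ∫⁻ x : Fin (n + 1) → ℝ × ℝ,
    ENNReal.ofReal (Real.exp (-(1 : ℝ)⁻¹ * hamiltonianIn P.chainPotential OscillatorChain.chainSupp Λ (insBox a n η x)))
    with hZl
  set bd : ChainConfig → ℝ := fun η => (η (a - 1)).1 ^ 2 + (η (a + n + 1)).1 ^ 2 with hbd
  set Good : Set ChainConfig := {σ : ChainConfig | |(σ (a - 1)).1| ≤ R ∧ |(σ (a + n + 1)).1| ≤ R} with hGood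
  have hU := measurable_U_harmonic ω₂ γ
  have hV := measurable_V_harmonic ω₂ γ
  have hΦm : Measurable Φ := Real.measurable_exp.comp (hψ.comp (boxRestrictAt_measurable a n))
  have hΦm' : Measurable fun σ => ENNReal.ofReal (Φ σ) := ENNReal.measurable_ofReal.comp hΦm
  have hΦ0 : ∀ σ, 0 ≤ Φ σ := fun σ => (Real.exp_pos _).le
  have hΦb : ∀ σ, Φ σ ≤ Real.exp Cψ := fun σ => Real.exp_le_exp.2 ((le_abs_self _).trans (hψb _))
  -- Step 1: `∫ Φ dμ` as a lintegral, and the DLR equation in `ℝ≥0∞`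
  have hint : ∫ σ, Φ σ ∂μ = (∫⁻ σ, ENNReal.ofReal (Φ σ) ∂μ).toReal :=
    integral_eq_lintegral_of_nonneg_ae (Eventually.of_forall hΦ0) hΦm.aestronglyMeasurable
  have hfin : ∫⁻ σ, ENNReal.ofReal (Φ σ) ∂μ ≤ ENNReal.ofReal (Real.exp Cψ) := by
    calc ∫⁻ σ, ENNReal.ofReal (Φ σ) ∂μ ≤ ∫⁻ _σ, ENNReal.ofReal (Real.exp Cψ) ∂μ :=
          lintegral_mono fun σ => ENNReal.ofReal_le_ofReal (hΦb σ)
      _ = ENNReal.ofReal (Real.exp Cψ) := by rw [lintegral_const, measure_univ, mul_one]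
  have hDLR : ∫⁻ σ, ENNReal.ofReal (Φ σ) ∂μ = ∫⁻ η, ∫⁻ σ, ENNReal.ofReal (Φ σ) ∂(P.chainSpecification 1 Λ η) ∂μ :=
    (Literature.Probability.LatticeModels.lintegral_lintegral_eq_of_dlr
      (fun A hA => P.measurable_chainSpecification_apply hU hV 1 Λ hA)
      (((P.isChainGibbsMeasure_iff 1 μ).1 hG).2 Λ) hΦm').symm
  -- Step 2: the kernel integral as `N/Z`, and its lower bound
  have hker : ∀ η, ∫⁻ σ, ENNReal.ofReal (Φ σ) ∂(P.chainSpecification 1 Λ η) = Nl η / Zl η := by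
    intro η
    rw [P.lintegral_chainSpecification_eq_lmarginal_div hU hV 1 Λ η (boxZ_lt_top ω₂ a n hω γ η).ne
      hΦm', hΛ, lmarginal_Icc_eq_lintegral_insBox, lmarginal_Icc_eq_lintegral_insBox]
    congr 1
    refine lintegral_congr fun x => ?_
    simp only [hΦ, boxRestrictAt_insBox]
    rw [← ENNReal.ofReal_mul (Real.exp_pos _).le]
  have hZle : ∀ η, Zl η ≤ ENNReal.ofReal (m ^ (n + 1)) := by
    intro η
    have h1 := boxZ_le_pow ω₂ a n γ η
    rw [lmarginal_Icc_eq_lintegral_insBox] at h1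
    have hz₀t : z₀ ≠ ∞ := (siteZ_lt_top ω₂ hω γ).ne
    calc Zl η ≤ z₀ ^ (n + 1) := h1
      _ = ENNReal.ofReal (z₀.toReal ^ (n + 1)) := by
          rw [ENNReal.ofReal_pow ENNReal.toReal_nonneg, ENNReal.ofReal_toReal hz₀t]
      _ ≤ ENNReal.ofReal (m ^ (n + 1)) :=
          ENNReal.ofReal_le_ofReal (pow_le_pow_left₀ ENNReal.toReal_nonneg (le_max_left _ _) _)
  have hNge : ∀ η, ENNReal.ofReal (Real.exp (Iψ - (n + 1) * A - bd η)) ≤ Nl η := fun η =>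
    boxN_ge ω₂ a n hω γ η hψ hψb
  have hratio : ∀ η, ENNReal.ofReal (Real.exp (Iψ - (n + 1) * A - bd η) / m ^ (n + 1)) ≤ Nl η / Zl η := by
    intro η
    rw [ENNReal.ofReal_div_of_pos (pow_pos hm0 _)]
    exact ENNReal.div_le_div (hNge η) (hZle η)
  -- Step 3: restrict to the good boundary conditions
  have hq : ∀ z : ℤ, Measurable fun σ : ChainConfig => |(σ z).1| := fun z => (measurable_pi_apply z).fst.abs
  have hGoodm : MeasurableSet Good := by
    rw [hGood, Set.setOf_and]
    exact (measurableSet_le (hq _) measurable_const).inter (measurableSet_le (hq _) measurable_const)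
  set e₂ : ℝ := Real.exp (Iψ - (n + 1) * A - 2 * R ^ 2) / m ^ (n + 1) with he₂
  have he₂0 : 0 ≤ e₂ := by positivity
  have hongood : ∀ η ∈ Good, e₂ ≤ Real.exp (Iψ - (n + 1) * A - bd η) / m ^ (n + 1) := by
    intro η hη
    obtain ⟨h1, h2⟩ := hη
    refine div_le_div_of_nonneg_right (Real.exp_le_exp.2 ?_) (pow_pos hm0 _).le
    have hb1 : (η (a - 1)).1 ^ 2 ≤ R ^ 2 := by
      rw [← sq_abs]; exact pow_le_pow_left₀ (abs_nonneg _) h1 2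
    have hb2 : (η (a + n + 1)).1 ^ 2 ≤ R ^ 2 := by
      rw [← sq_abs]; exact pow_le_pow_left₀ (abs_nonneg _) h2 2
    simp only [hbd]
    linarith
  have hlow : ENNReal.ofReal e₂ * μ Good ≤ ∫⁻ σ, ENNReal.ofReal (Φ σ) ∂μ := by
    rw [hDLR, ← lintegral_indicator_const hGoodm]
    refine lintegral_mono fun η => ?_
    by_cases hη : η ∈ Good
    · rw [indicator_of_mem hη, hker]
      exact (ENNReal.ofReal_le_ofReal (hongood η hη)).trans (hratio η)
    · rw [indicator_of_notMem hη]; exact bot_le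
  have hμGood : ENNReal.ofReal (1 / 2) ≤ μ Good := by
    rw [← ENNReal.ofReal_toReal (measure_ne_top μ Good)]
    exact ENNReal.ofReal_le_ofReal (hgood _ _)
  have hlow' : ENNReal.ofReal (e₂ * (1 / 2)) ≤ ∫⁻ σ, ENNReal.ofReal (Φ σ) ∂μ := by
    rw [ENNReal.ofReal_mul he₂0]
    exact (mul_le_mul' le_rfl hμGood).trans hlow
  -- Step 4: back to real numbers
  have hreal : e₂ * (1 / 2) ≤ ∫ σ, Φ σ ∂μ := by
    rw [hint]
    exact (ENNReal.ofReal_le_iff_le_toReal (ne_top_of_le_ne_top ENNReal.ofReal_ne_top hfin)).1 hlow'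
  refine le_trans (le_of_eq ?_) hreal
  simp only [he₂]
  rw [show m ^ (n + 1) = Real.exp ((n + 1) * Real.log m) by
      rw [← Real.exp_log (pow_pos hm0 (n + 1)), Real.log_pow]; push_cast; ring,
    show (1 / 2 : ℝ) = Real.exp (-Real.log 2) by rw [Real.exp_neg, Real.exp_log two_pos]; norm_num,
    div_eq_mul_inv, ← Real.exp_neg, ← Real.exp_add, ← Real.exp_add]
  congr 1
  ring

/-- **The radiating Gaussian state of the harmonic chain is regular.** For `ω₂ > 0` there are a
shift-invariant DLR Gibbs state `μ` of `pinnedChain ω₂ 0 0 γ` at temperature `T = 1` and `C < ∞` with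
`H(ν_Λ ‖ μ_Λ) ≤ C (n+1)` for every box `Λ = {a, …, a+n}` (`ν = harmonicState ω₂`). [folklore] -/
theorem regular_harmonicState (hω : 0 < ω₂) (γ : ℝ) :
    ∃ μ : Measure ChainConfig, (pinnedChain ω₂ 0 0 γ).IsChainGibbsMeasure 1 μ ∧ IsShiftInvariant μ ∧
      ∃ C : ℝ≥0∞, C ≠ ∞ ∧ ∀ (a : ℤ) (n : ℕ),
        klDiv (boxMarginal a n (harmonicState ω₂)) (boxMarginal a n μ) ≤ C * (n + 1) := by
  obtain ⟨μ, R, hG, hS, hprob, hR0, hgood⟩ := exists_gibbs_boundary_control ω₂ hω γ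
  set A : ℝ := ((noiseVar ω₂ 1 : ℝ) + 2) / 2 + (ω₂ / 2 + 2) -
    (Real.log (Real.sqrt (2 * Real.pi)) + Real.log (Real.sqrt (2 * Real.pi * noiseVar ω₂ 1))) with hA
  set Lm : ℝ := Real.log (max (∫⁻ z : ℝ × ℝ, ENNReal.ofReal (Real.exp (-(1 : ℝ)⁻¹ *
    (z.2 ^ 2 / 2 + (pinnedChain ω₂ 0 0 γ).U z.1)))).toReal 1) with hLm
  have hLm0 : 0 ≤ Lm := Real.log_nonneg (le_max_right _ _)
  set C' : ℝ := A + Lm + 2 * R ^ 2 + Real.log 2 with hC'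
  have hlog2 : 0 ≤ Real.log 2 := Real.log_nonneg (by norm_num)
  refine ⟨μ, hG, hS, ENNReal.ofReal (max C' 0), ENNReal.ofReal_ne_top, fun a n => ?_⟩
  -- the Donsker–Varadhan bound with constant `(n+1) C'`
  have key : klDiv (boxMarginal a n (harmonicState ω₂)) (boxMarginal a n μ) ≤ ENNReal.ofReal ((n + 1) * C') := by
    refine Literature.Probability.Divergences.klDiv_le_of_forall_integral_le fun ψ Cψ hψ hψb => ?_
    have h := exp_le_integral_exp_comp_box ω₂ hω γ hG hgood a n hψ hψb
    have hm : AEStronglyMeasurable (fun x => Real.exp (ψ x)) (μ.map (boxRestrictAt a n)) :=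
      (Real.measurable_exp.comp hψ).aestronglyMeasurable
    rw [← integral_map (boxRestrictAt_measurable a n).aemeasurable hm] at h
    change Real.exp _ ≤ ∫ x, Real.exp (ψ x) ∂boxMarginal a n μ at h
    have hpos : 0 < ∫ x, Real.exp (ψ x) ∂boxMarginal a n μ := lt_of_lt_of_le (Real.exp_pos _) h
    have h2 := (Real.le_log_iff_exp_le hpos).2 h
    have hn : (0 : ℝ) ≤ n := Nat.cast_nonneg n
    nlinarith [h2, hLm0, hlog2, sq_nonneg R]
  refine key.trans ?_
  calc ENNReal.ofReal ((n + 1) * C') ≤ ENNReal.ofReal ((n + 1) * max C' 0) :=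
        ENNReal.ofReal_le_ofReal (mul_le_mul_of_nonneg_left (le_max_left _ _) (by positivity))
    _ = ENNReal.ofReal (max C' 0) * (n + 1) := by
        rw [mul_comm, ENNReal.ofReal_mul (le_max_right _ _)]
        congr 1
        rw [show (n : ℝ) + 1 = ((n + 1 : ℕ) : ℝ) by push_cast; ring, ENNReal.ofReal_natCast]
        push_cast; ring

end Summit.AtomisticToContinuum.FouriersLaw.Theorems.ParityLiouvilleSeed.HarmonicWitness

end
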